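/-
Copyright: cell `langlands-arthur-audit` (papers/Langlands/langlands-arthur-audit), units `pub-arthur-typer`
(gen 1, 2026-08-18T14:35Z) and `pub-arthur-typer-g2` (this tree version).  Staged for the tree under
`Literature/NumberTheory/Automorphic/Arthur2013/` (LEAN-IN-TREE rule 2026-08-18) from the cell module
`HOME/lean/ArthurAudit/ArthurAudit/Leaves.lean` (core Lean): namespace renamed, `import HarnessLib` added for the
gate's audit commands, one provenance tag per declaration, every quotation re-verified against the staged TeX
sources (two gen-1 misquotations corrected: CITED-FACTS TY-1, GAPS G-TY-5), the 2026 status TABLE removed (the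
cell keeps ONE table: module `Upstream`), the local classification statement and the complex-place findings added.
-/
import Literature.NumberTheory.Automorphic.Arthur2013.Leaves.Packets

/-!
# Arthur (2013) audit, typed leaves — §7 archimedean places, inner forms, region witnesses

§7: archimedean inputs (L20, with the complex-place findings), the inner-form programme ([KMSW] and its unwritten sequels; the Book's Ch. 9), and the region witnesses `innerForms_nongeneric_unsupplied`, `innerSymplectic_unstated`, `LocalClassification.generic_separates`.
Overview, sources, design and conventions: the module docstring of `Leaves/Scopes.lean` (same directory).
Schematic simplifications: the cell's `DIVERGENCE.md` (D-TY-01 … D-TY-21).  No `axiom`, `sorry`, `opaque`.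
-/

set_option autoImplicit false

namespace Literature.NumberTheory.Automorphic.Arthur2013.Leaves

/-! ## §7  Archimedean inputs (L20), the inner-form programme ([KMSW] sequels), and region witnesses -/

section ArchimedeanAndInner

/-- **L20 supplied region** — [AGIKMS] App. E "Endoscopic character relations for the archimedean case"
(`note30.tex:L14296`), VERBATIM (`L14297–L14306`): "In this appendix, we will argue that \cite[Theorem
2.2.1(a)]{Ar} holds for $F=\R$ and tempered parameters $\psi=\phi$, and that \cite[Theorem 2.2.4]{Ar} holds for
$F=\R$ and discrete parameters $\psi=\phi$. The validity of these theorems is assumed at various places in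
\cite{Ar} with the remark that they will follow from a forthcoming work of Shelstad and Mezo. In the meantime,
the work of Shelstad \cite{She12} has appeared, which proves the transfer of functions in twisted endoscopy for
$F=\R$, and the works of Mezo \cite{Mez13, Mez16}, which prove a weaker version of the desired theorems: the
character identities are shown to hold up to a scalar."; (`L14308–L14309`) "For the proof of \cite[Theorem
2.2.4]{Ar} we will use the recent work \cite{KM26} (which treats a general class of disconnected real reductive
groups and $L$-parameters that are discrete for the identity component)"; the class of [KM26] as used there
(`L14321–L14323`): "rigid inner forms of groups of the form $G^+ = G \rtimes A$, where $G$ is a quasi-split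
connected reductive $\R$-group and $A$ is a finite group of automorphisms of $G$ that preserve an $\R$-pinning".
Region named: `F = ℝ`, quasi-split, tempered generic.  The place `F = ℂ` is NOT named in App. E (the only
occurrences of `F=\C` in the source, `L14916`, `L14931`, concern class-field-theory conventions); whether the
restriction of scalars `Res_{ℂ/ℝ} G` is meant to fall under "[a] quasi-split connected reductive $\R$-group" is
not said.  STATUS: PREPRINT resting on the 2026 preprint [KM26]; App. E runs INSIDE the Book's induction (uses
[Ar] Prop 6.3.1, Lemma 5.4.2, Prop 6.6.1; `Nodes.TECR_R` of module `DependencyDag` is rank-indexed for that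
reason).
[claim: AGIKMS2024, under-review] (Appendix E, l.14296-14323) -/
abbrev L20.supplied (s : LocalClassicalScope) : Prop :=
  s.field = .real ∧ s.form = .quasiSplit ∧ s.params = .temperedGeneric

/-- **L20 consumed region**: the Book invokes the archimedean twisted character identities at ALL archimedean
places `v` of the number field ([AGIKMS] `note30.tex:L14300–L14301`: "The validity of these theorems is assumed
at various places in \cite{Ar}"), i.e. for `G(F_v)`, `F_v ∈ {ℝ, ℂ}`, for the symplectic / orthogonal types.
For [Mok] the archimedean case MEANS `F = ℝ`: `src/1206.0882/main.tex:L7231`, VERBATIM: "We next consider the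
case where $F$ is archimedean, i.e. $F \cong \mathbf{R}$ and $E \cong \mathbf{C}$." — a complex place of `F`
splits in `E`, where (`L3990`, VERBATIM) "Note that if $v$ splits in $E$ then these assertions are elementary,
namely that the corresponding assertions of theorem 2.4.10 and theorem 3.2.1 in this case is already known."
Hence: archimedean ∧ quasi-split ∧ tempered generic ∧ (Arthur type, any archimedean place ∨ Mok type, `F = ℝ`).
On the [MW] side `F = ℂ` is covered by restriction of scalars ([MW IV] arXiv:1403.1454 `main.tex:L823`; [MW V]
arXiv:1406.2257 `L2269–L2270`; [MW X] arXiv:1412.2981 `L676`).  Whether anything beyond restriction of scalars /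
parabolic descent is needed at `F = ℂ` for `Sp_{2n}`, `SO_m` is discussed in none of the held sources — recorded
as an open QUESTION of the audit, not a finding (GAPS G-TY-3; DIVERGENCE D-TY-11).
[cite: Arthur2013, Thms 2.2.1(a)/2.2.4 at archimedean places as consumed (second-hand: AGIKMS2024 l.14297-14301; Mok2012 l.7231, l.3990)] -/
abbrev L20.needed (s : LocalClassicalScope) : Prop :=
  s.field.isArchimedean = true ∧ s.form = .quasiSplit ∧ s.params = .temperedGeneric ∧
    (s.type.isArthur = true ∨ (s.type.isMok = true ∧ s.field = .real))

/-- the complex place of a symplectic group: in the consumed region, outside the region App. E names.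
[folklore] (explicit witness) -/
def complexPlaceScope : LocalClassicalScope :=
  { field := .complex, type := .Sp 2, form := .quasiSplit, params := .temperedGeneric }

/-- **L20 witness**: the complex place of `Sp_4` is consumed and not named by the 2026 supplier.
[cite: AGIKMS2024, App. E l.14297-14299 names F = ℝ only (region comparison decided here)] -/
theorem L20.complex_place_unnamed :
    L20.needed complexPlaceScope ∧ ¬ L20.supplied complexPlaceScope := by
  decide

/-- For Mok's unitary groups the complex-place question is VACUOUS: a unitary scope over `ℂ` is not in the
consumed region (complex places split in `E`; [Mok] l.7231, l.3990).
[cite: Mok2012, l.3990 and l.7231 (decided here)] -/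
theorem L20.mok_complex_vacuous :
    ¬ L20.needed { field := .complex, type := .U 3, form := .quasiSplit, params := .temperedGeneric } := by
  decide

/-- At the REAL place the consumed region is covered by App. E (modulo its preprint status).
[folklore] (bookkeeping) -/
theorem L20.real_covered : ∀ s, L20.needed s → s.field = .real → L20.supplied s :=
  fun _ ⟨_, h2, h3, _⟩ hr => ⟨hr, h2, h3⟩

/-- **[KMSW] = Kaletha–Mínguez–Shin–White, arXiv:1409.3731v3 — what is deferred to the unwritten sequels.**
VERBATIM: (`src/1409.3731/chap1mainthms.tex:L86`) "The following local classification theorem is our main local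
result. In this paper we establish it under the hypothesis that $\psi$ is generic. The theorem will be proven in
full in the next paper \cite{KMS_A}."; (`L355`) "Theorem \ref{thm:main-global} will be completely proved in
\cite{KMS_A} if $(G,\xi)$ is realized as a pure inner twist and in \cite{KMS_B} in general. More precisely we
prove the theorem in Chapter \ref{chapter5} under two hypotheses, which are resolved in \cite{KMS_A} and
\cite{KMS_B} in the corresponding cases. The unconditional result of this paper towards the theorem,  is a natural
decomposition of $L^2_{\disc}(G(F)\bs G(\A_F))$ according to the parameters $\psi\in \Psi(G^*,\eta_{\chi_
\kappa})$ only when $\psi$ is generic and $(G,\xi)$ comes from a pure inner twist".  STATUS 2026-08-18: neither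
sequel has appeared (cell `inputs/INDEX.md`).  LOCAL statements of [KMSW] deferred to [KMS_A]: inner forms of
unitary groups (extended pure inner twists), `F` of characteristic zero, NON-generic `ψ`.
[cite: KalethaEtAl2014, Thm* 1.6.1 preamble (arXiv v3 chap1mainthms.tex l.86)] -/
abbrev KMSW.localDeferred (s : LocalClassicalScope) : Prop :=
  (∃ n, s.type = .U n) ∧ s.field.isCharZero = true ∧ s.params ≠ .temperedGeneric

/-- what [KMSW] proves of its LOCAL theorem: all extended pure inner twists of unitary groups, generic `ψ`
(`chap1mainthms.tex:L86`). [cite: KalethaEtAl2014, Thm* 1.6.1 for generic ψ (chap1mainthms.tex l.86)] -/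
abbrev KMSW.localProved (s : LocalClassicalScope) : Prop :=
  (∃ n, s.type = .U n) ∧ s.field.isCharZero = true ∧ s.params = .temperedGeneric

/-- the full LOCAL statement of [KMSW] (generic or not). [cite: KalethaEtAl2014, Thm* 1.6.1 as stated] -/
abbrev KMSW.localStated (s : LocalClassicalScope) : Prop :=
  (∃ n, s.type = .U n) ∧ s.field.isCharZero = true

/-- [KMSW]: the deferred local region is disjoint from the proved one. [folklore] (bookkeeping) -/
theorem KMSW.localDeferred_disjoint_proved :
    ∀ s, KMSW.localDeferred s → ¬ KMSW.localProved s :=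
  fun _ ⟨_, _, h⟩ ⟨_, _, hp⟩ => h hp

/-- GLOBAL theorem of [KMSW] (`thm:main-global`): unconditional in [KMSW] only for (generic `ψ`, pure inner
twist); the rest deferred — pure inner twists to [KMS_A], general `(G, ξ)` to [KMS_B] (`chap1mainthms.tex:L355`).
Typed on `GlobalScope × Bool` (`generic`).
[cite: KalethaEtAl2014, §1.7 paragraph after Thm* 1.7.1 (chap1mainthms.tex l.355)] -/
abbrev KMSW.globalProved (s : GlobalScope) (generic : Bool) : Prop :=
  s.field = .numberField ∧ (∃ n, s.type = .U n) ∧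
    (s.form = .pureInner ∨ s.form = .quasiSplit) ∧ generic = true

/-- GLOBAL statement of [KMSW] deferred to the sequels. [cite: KalethaEtAl2014, chap1mainthms.tex l.355 (deferral to KMS_A / KMS_B)] -/
abbrev KMSW.globalDeferred (s : GlobalScope) (generic : Bool) : Prop :=
  s.field = .numberField ∧ (∃ n, s.type = .U n) ∧
    (s.form = .extendedPure ∨ s.form = .inner ∨ generic = false)

/-- [KMSW]: the deferred global region is disjoint from the proved one. [folklore] (bookkeeping) -/
theorem KMSW.globalDeferred_disjoint_proved :
    ∀ s g, KMSW.globalDeferred s g → ¬ KMSW.globalProved s g := by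
  intro s g ⟨_, _, h⟩ ⟨_, _, hf, hg⟩
  cases h with
  | inl h => cases hf with
    | inl hf => rw [hf] at h; exact Form.noConfusion h
    | inr hf => rw [hf] at h; exact Form.noConfusion h
  | inr h => cases h with
    | inl h => cases hf with
      | inl hf => rw [hf] at h; exact Form.noConfusion h
      | inr hf => rw [hf] at h; exact Form.noConfusion h
    | inr h => rw [hg] at h; exact Bool.noConfusion h

/-- Region on which the 2024–2026 suppliers of the Book's deferred LOCAL references are stated ([AGIKMS]
`main1`, `main2`, `main3`, Thm D.2.1, App. E; L16–L20): quasi-split groups only.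
[claim: AGIKMS2024, under-review] (all main theorems are stated for quasi-split G; union of regions recorded here) -/
abbrev AGIKMS.localRegion (s : LocalClassicalScope) : Prop := s.form = .quasiSplit

/-- a NON-quasi-split unitary scope with NON-generic parameters over a `p`-adic field: stated by [KMSW],
deferred to the unwritten [KMS_A], outside every quasi-split supplier. [folklore] (explicit witness) -/
def innerUnitaryScope : LocalClassicalScope :=
  { field := .nonarch 7 true, type := .U 3, form := .extendedPure, params := .general }

/-- **Inner forms, decided**: the scope `innerUnitaryScope` is in [KMSW]'s stated local region and in its
deferred region, and in none of `KMSW.localProved`, `AGIKMS.localRegion`, `Book.localStated`, `Mok.localStated`.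
[cite: KalethaEtAl2014, chap1mainthms.tex l.86 (deferral; region comparison decided here)] -/
theorem innerForms_nongeneric_unsupplied :
    KMSW.localStated innerUnitaryScope ∧ KMSW.localDeferred innerUnitaryScope ∧
      ¬ KMSW.localProved innerUnitaryScope ∧ ¬ AGIKMS.localRegion innerUnitaryScope ∧
      ¬ Book.localStated innerUnitaryScope ∧ ¬ Mok.localStated innerUnitaryScope := by
  refine ⟨⟨⟨3, rfl⟩, rfl⟩, ⟨⟨3, rfl⟩, rfl, by decide⟩, ?_, by decide, by decide, by decide⟩
  intro ⟨_, _, h⟩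
  exact absurd h (by decide)

/-- an inner form of a SYMPLECTIC group over a `p`-adic field, generic parameters: outside the stated regions
of all three programmes audited here (the Book states quasi-split; [KMSW] is unitary). [folklore] (explicit witness) -/
def innerSymplecticScope : LocalClassicalScope :=
  { field := .nonarch 7 true, type := .Sp 2, form := .inner, params := .temperedGeneric }

/-- **Inner forms of `Sp`/`SO`, decided**: not in the stated local region of the Book, of [Mok], or of [KMSW],
nor in the 2026 suppliers' region.
[cite: KalethaEtAl2014, Introduction main.tex l.66-68 (scope: inner forms of UNITARY groups; decided here)] -/
theorem innerSymplectic_unstated :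
    ¬ Book.localStated innerSymplecticScope ∧ ¬ Mok.localStated innerSymplecticScope ∧
      ¬ KMSW.localStated innerSymplecticScope ∧ ¬ AGIKMS.localRegion innerSymplecticScope := by
  refine ⟨by decide, by decide, ?_, by decide⟩
  intro ⟨⟨_, h⟩, _⟩
  exact ClassicalType.noConfusion h

/-- World separating generic from non-generic scopes for the local classification statement: the twisted
trace is `0` at tempered-generic scopes and `1` elsewhere, all characters `Θ_π` vanish.
[folklore] (explicit structure) -/
def genericOnlyWorld : World :=
  { World.trivial with twTrace := fun s _ _ => if s.params = .temperedGeneric then 0 else 1 }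

/-- shape data for `genericOnlyWorld`: every parameter has the empty shape (`t = 0`, `ψ_bad = 0`), index `1`.
[folklore] (explicit structure) -/
def genericOnlyShape : ShapeData genericOnlyWorld where
  shape _ _ := { k := 0, lbl := fun i => i.elim0, dimφ := fun i => i.elim0, d := fun i => i.elim0,
                 d_pos := fun i => i.elim0, dimBad := 0 }
  indexGG0 _ := 1

/-- In any world whose characters all vanish, the right side of (ECR1) vanishes. [folklore] (list bookkeeping) -/
theorem sum_map_mul_zero {α : Type} (l : List α) (c : α → Val) :
    (l.map fun a => c a * 0).sum = 0 := by
  induction l with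
  | nil => rfl
  | cons a t ih =>
    rw [List.map_cons, List.sum_cons, ih, Int.mul_zero]
    rfl

/-- **LOCAL CLASSIFICATION: proved-generic versus stated-for-all, kernel-checked.**  A world and shape data in
which the local classification statement holds on [KMSW]'s PROVED region (generic `ψ`, all extended pure inner
twists of unitary groups) and on the Book's / [Mok]'s tempered-generic slices, and FAILS on [KMSW]'s STATED
region (all `ψ`) — the non-generic inner-form case deferred to the unwritten [KMS_A].
[cite: KalethaEtAl2014, Thm* 1.6.1 "under the hypothesis that ψ is generic" (l.86; separation model constructed here)] -/
theorem LocalClassification.generic_separates :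
    ∃ (Ω : World) (D : ShapeData Ω),
      LocalClassification Ω D KMSW.localProved ∧ ¬ LocalClassification Ω D KMSW.localStated := by
  refine ⟨genericOnlyWorld, genericOnlyShape, ?_, ?_⟩
  · intro s hs p
    let χ : (genericOnlyShape.shape s p).AChar :=
      { val := fun i => i.elim0, triv_A0 := fun i => i.elim0, triv_z := rfl }
    refine ⟨{ members := [()], pairing := fun _ => χ }, ?_, ?_⟩
    · intro fN f _
      show ((1 : Nat) : Val) * (if s.params = ParamKind.temperedGeneric then (0 : Val) else 1) =
        (([()] : List Unit).map fun π => (χ.atS) * (0 : Val)).sum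
      rw [if_pos hs.2.2, sum_map_mul_zero]
      rfl
    · intro _
      refine ⟨List.Pairwise.cons (fun _ h => nomatch h) List.Pairwise.nil, ?_, ?_⟩
      · intro π _ π' _ _
        cases π; cases π'; rfl
      · intro _ χ'
        refine ⟨(), List.mem_singleton.mpr rfl, ?_⟩
        cases χ' with
        | mk v hA hz =>
          have hv : (fun i : Fin 0 => i.elim0) = v := funext fun i => i.elim0
          subst hv
          rfl
  · intro H
    have hst : KMSW.localStated innerUnitaryScope := ⟨⟨3, rfl⟩, rfl⟩
    obtain ⟨P, hE, _⟩ := H innerUnitaryScope hst ()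
    have h := hE () () True.intro
    have h' : ((1 : Nat) : Val) * (if innerUnitaryScope.params = ParamKind.temperedGeneric then (0 : Val)
        else 1) = (P.members.map fun π => (P.pairing π).atS * (0 : Val)).sum := h
    rw [if_neg (by decide), sum_map_mul_zero] at h'
    exact absurd h' (by decide)

end ArchimedeanAndInner

end Literature.NumberTheory.Automorphic.Arthur2013.Leaves
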